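import Mathlib
import HarnessLib
import Summits.Ventures.LatticeQCDFlow.Exactness.MomentumRefresh
import Summits.Ventures.LatticeQCDFlow.Exactness.SplittingWords
import Summits.Ventures.LatticeQCDFlow.Exactness.RefreshScan
import Summits.Ventures.LatticeQCDFlow.Exactness.DoeblinUniqueness

/-!
# A Doeblin minorant for refresh–propose–accept–forget, and the one-step P-first leapfrog

HONEST FRAMING: exact (Metropolis-corrected) sampling algorithms for lattice gauge theory;
figures of merit are autocorrelation/cost numbers at stated couplings and volumes; no
continuum-physics claim.

Venture `LatticeQCDFlow` (cell pub-lqcd), topic `Exactness`, FANOUT row 9 (eng-latcore, the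
engine `latflow.core.hmc.HMC(..., integrator='leapfrog')`).  NEW WORK of the cell over Mathlib and
the tree's `MomentumRefresh.lean` (`refreshUpdate`), `InvolutiveMetropolis.lean` (`involMH`),
`SplittingIntegrator.lean` / `SplittingWords.lean` (`flip`, `kick`, `drift`, `palindromicWord`),
`RefreshScan.lean` (`uniformlyErgodic_of_minorised`) and `DoeblinUniqueness.lean`
(`invariant_unique_of_minorised`); nothing here is cited as a fact.  Printed counterparts, named
only: Duane–Kennedy–Pendleton–Roweth 1987 (HMC), Meyn–Tweedie ch. 16 (Doeblin / uniform ergodicity).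

The tree types HMC as EXACT (`hmc_config_exact`, `gauge_hmc_leapfrog_config_exact`,
`palindromicHMC_invariant`) and lists ergodicity of the configuration chain as NOT typed
(`TYPED-EXACTNESS-MAP.md`).  This file is the abstract half of a Doeblin certificate for the HMC
configuration kernel `refreshUpdate (involMH Ψ _ H) μP` (refresh the momenta `π ∼ μP`, propose
`Ψ (u, π)`, Metropolis test on `H`, forget the momenta):

* §1 `refreshUpdate_involMH_minorised` — if a sub-law `ρ ≤ μP` of the momentum refresh sees an
  acceptance probability `≥ a` (`ρ`-a.e., from every configuration) and the PROPOSED CONFIGURATION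
  `(Ψ (u, π)).1`, `π ∼ ρ`, dominates `δ • π₀` from every `u`, then the configuration kernel dominates
  `(a δ) • π₀` from every `u` (a Doeblin minorant); `le_involAcceptE_of_le` — an energy window
  `H (Ψ x) ≤ H x + B` gives `a = e^{−B}`; `refreshUpdate_involMH_uniformlyErgodic` /
  `refreshUpdate_involMH_invariant_unique` — with an invariant probability law (exactness) the
  chain converges to it geometrically from every start and that law is the only invariant one.
* §2 `prod_mul_lmarginal_le`, `smul_pi_le_pi` — product bookkeeping: `cᵢ • μᵢ ≤ νᵢ` for every
  coordinate gives `(∏ cᵢ) • ⊗μᵢ ≤ ⊗νᵢ` (by `lmarginal` induction; Mathlib has `Measure.prod_mono`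
  but no `pi` version), so link-wise minorants multiply over the lattice.
* §3 the ONE-STEP P-FIRST LEAPFROG `K(g) D(d) K(g)` (`palindromicWord [kick g] (drift d)`, the
  engine's `'leapfrog'` step `P ← P − ½εF`, `U ← exp(εP)U`, `P ← P − ½εF` at `nstep = 1`):
  `flip_kdk_apply`, `fst_flip_kdk` — the proposed configuration is `d (π + g u) u`, ONE drift of the
  kicked momentum; `kdkHMC_minorised` — §1 specialised: it suffices that the law of `d (π + g u) u`,
  `π ∼ ρ`, dominates `δ • π₀` from every `u`.

The group-specific input — one exponential drift of a Lebesgue-minorised momentum dominates a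
multiple of Haar measure — is a separate file (`SU2ExpChartMinorisation.lean`), as is the engine
instance.  NOT here: trajectories with `nstep ≥ 2` or the OMF words (two or more drifts: the
proposed configuration is no longer a single push-forward and no hypothesis-free minorant is
claimed — fixed-length trajectories can be non-ergodic, Mackenzie 1989), rates of practical use.
-/

namespace Summit.Ventures.LatticeQCDFlow.Exactness

open MeasureTheory ProbabilityTheory ProbabilityTheory.Kernel
open scoped ENNReal

/-! ## §1 A Doeblin minorant for refresh–propose–accept–forget -/

section Generic

variable {Ω P : Type*} [MeasurableSpace Ω] [MeasurableSpace P]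

/-- An energy window bounds the acceptance from below: if `H (Ψ x) ≤ H x + B` with `B ≥ 0` then
the Metropolis acceptance `min {1, e^{H x − H (Ψ x)}}` is at least `e^{−B}`. -/
theorem le_involAcceptE_of_le {X : Type*} {H : X → ℝ} {Ψ : X → X} {B : ℝ} (hB : 0 ≤ B) {x : X}
    (h : H (Ψ x) ≤ H x + B) : ENNReal.ofReal (Real.exp (-B)) ≤ involAcceptE H Ψ x := by
  unfold involAcceptE involAccept
  refine ENNReal.ofReal_le_ofReal (le_min ?_ (Real.exp_le_exp.2 (by linarith)))
  rw [Real.exp_le_one_iff]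
  linarith

/-- The deterministic-proposal Metropolis kernel puts at least mass `a(x) · 1_B(Ψ x)` on `B`. -/
theorem involAcceptE_mul_indicator_le_involMH {X : Type*} [MeasurableSpace X] {Ψ : X → X}
    (hΨ : Measurable Ψ) {H : X → ℝ} (hH : Measurable H) (x : X) {B : Set X}
    (hB : MeasurableSet B) :
    involAcceptE H Ψ x * B.indicator 1 (Ψ x) ≤ involMH Ψ hΨ H x B := by
  rw [involMH_apply hH x hB]
  exact le_self_add

/-- **Doeblin minorant for refresh–propose–accept–forget.**  `μP` the momentum refresh law,
`ρ ≤ μP` a sub-law on which, from every configuration `u`, the acceptance probability of the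
proposal `Ψ (u, π)` is at least `a` (`ρ`-a.e. in `π`), and such that the proposed CONFIGURATION
`(Ψ (u, π)).1`, `π ∼ ρ`, dominates `δ • π₀` from every `u`.  Then the configuration kernel
`refreshUpdate (involMH Ψ _ H) μP` dominates `(a δ) • π₀` from every `u`. -/
theorem refreshUpdate_involMH_minorised {Ψ : Ω × P → Ω × P} (hΨ : Measurable Ψ) {H : Ω × P → ℝ}
    (hH : Measurable H) (μP : Measure P) [SFinite μP] {ρ : Measure P} (hρ : ρ ≤ μP) {a : ℝ≥0∞}
    (hacc : ∀ u, ∀ᵐ p ∂ρ, a ≤ involAcceptE H Ψ (u, p)) {π₀ : Measure Ω} {δ : ℝ≥0∞}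
    (hpush : ∀ u, δ • π₀ ≤ ρ.map (fun p => (Ψ (u, p)).1)) (u : Ω) :
    (a * δ) • π₀ ≤ refreshUpdate (involMH Ψ hΨ H) μP u := by
  refine Measure.le_iff.2 fun A hA => ?_
  have hA' : MeasurableSet (Prod.fst ⁻¹' A : Set (Ω × P)) := measurable_fst hA
  have hΨu : Measurable fun p : P => Ψ (u, p) := hΨ.comp measurable_prodMk_left
  have hΨ1 : Measurable fun p : P => (Ψ (u, p)).1 := measurable_fst.comp hΨu
  have hind : Measurable fun p : P => (Prod.fst ⁻¹' A : Set (Ω × P)).indicator 1 (Ψ (u, p)) :=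
    ((show Measurable (1 : Ω × P → ℝ≥0∞) from measurable_one).indicator hA').comp hΨu
  have hδ := Measure.le_iff.1 (hpush u) A hA
  rw [Measure.smul_apply, smul_eq_mul, Measure.map_apply hΨ1 hA] at hδ
  rw [Measure.smul_apply, smul_eq_mul, refreshUpdate_apply' _ _ _ hA]
  -- the preimage under the proposed configuration, as an integral of an indicator
  have hpre : ρ ((fun p : P => (Ψ (u, p)).1) ⁻¹' A) =
      ∫⁻ p, (Prod.fst ⁻¹' A : Set (Ω × P)).indicator 1 (Ψ (u, p)) ∂ρ := by
    rw [← lintegral_indicator_one (hΨ1 hA)]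
    rfl
  calc a * δ * π₀ A ≤ a * ρ ((fun p : P => (Ψ (u, p)).1) ⁻¹' A) := by
        rw [mul_assoc]; gcongr
    _ = ∫⁻ p, a * (Prod.fst ⁻¹' A : Set (Ω × P)).indicator 1 (Ψ (u, p)) ∂ρ := by
        rw [hpre, lintegral_const_mul _ hind]
    _ ≤ ∫⁻ p, involAcceptE H Ψ (u, p) * (Prod.fst ⁻¹' A : Set (Ω × P)).indicator 1 (Ψ (u, p)) ∂ρ :=
        lintegral_mono_ae ((hacc u).mono fun p hp => by gcongr)
    _ ≤ ∫⁻ p, involAcceptE H Ψ (u, p) * (Prod.fst ⁻¹' A : Set (Ω × P)).indicator 1 (Ψ (u, p)) ∂μP :=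
        lintegral_mono' hρ le_rfl
    _ ≤ ∫⁻ p, involMH Ψ hΨ H (u, p) (Prod.fst ⁻¹' A) ∂μP :=
        lintegral_mono fun p => involAcceptE_mul_indicator_le_involMH hΨ hH (u, p) hA'

/-- **Uniform ergodicity of the configuration chain from a Doeblin minorant.**  If the
configuration kernel dominates `δ • π₀` from every state (`π₀` a probability law) and leaves the
probability law `π` invariant (exactness), then `|μ₀Kᵗ(A) − π(A)| ≤ (1 − δ)ᵗ` for every initial
law `μ₀`, every `t`, every set `A`. -/
theorem refreshUpdate_involMH_uniformlyErgodic {Ψ : Ω × P → Ω × P} (hΨ : Measurable Ψ)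
    {H : Ω × P → ℝ} (hH : Measurable H) (μP : Measure P) [IsProbabilityMeasure μP]
    {π₀ : Measure Ω} [IsProbabilityMeasure π₀] {δ : ℝ≥0∞}
    (hmin : ∀ u, δ • π₀ ≤ refreshUpdate (involMH Ψ hΨ H) μP u) {π : Measure Ω}
    [IsProbabilityMeasure π] (hπ : Invariant (refreshUpdate (involMH Ψ hΨ H) μP) π)
    (μ₀ : Measure Ω) [IsProbabilityMeasure μ₀] (t : ℕ) (A : Set Ω) :
    |((fun m : Measure Ω => m.bind (refreshUpdate (involMH Ψ hΨ H) μP))^[t] μ₀).real A - π.real A|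
      ≤ (1 - δ.toReal) ^ t := by
  haveI : Fact (Measurable H) := ⟨hH⟩
  exact uniformlyErgodic_of_minorised hmin hπ μ₀ t A

/-- **Uniqueness of the invariant law from a Doeblin minorant.**  Under the same minorant with
`δ > 0`, two invariant probability laws of the configuration kernel coincide. -/
theorem refreshUpdate_involMH_invariant_unique {Ψ : Ω × P → Ω × P} (hΨ : Measurable Ψ)
    {H : Ω × P → ℝ} (hH : Measurable H) (μP : Measure P) [IsProbabilityMeasure μP]
    {π₀ : Measure Ω} [IsProbabilityMeasure π₀] {δ : ℝ≥0∞}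
    (hmin : ∀ u, δ • π₀ ≤ refreshUpdate (involMH Ψ hΨ H) μP u) (hδ : 0 < δ) {π π' : Measure Ω}
    [IsProbabilityMeasure π] [IsProbabilityMeasure π']
    (hπ : Invariant (refreshUpdate (involMH Ψ hΨ H) μP) π)
    (hπ' : Invariant (refreshUpdate (involMH Ψ hΨ H) μP) π') : π' = π := by
  haveI : Fact (Measurable H) := ⟨hH⟩
  exact invariant_unique_of_minorised hmin hδ hπ hπ'

end Generic

/-! ## §2 Product bookkeeping: coordinate-wise minorants multiply -/

section Pi

variable {ι : Type*} [DecidableEq ι] {X : ι → Type*} [∀ i, MeasurableSpace (X i)]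
  {μ ν : ∀ i, Measure (X i)} [∀ i, SigmaFinite (μ i)] [∀ i, SigmaFinite (ν i)] {c : ι → ℝ≥0∞}

/-- `lmarginal` is monotone in the family of measures, with constants: `cᵢ • μᵢ ≤ νᵢ` for all `i`
gives `(∏_{i ∈ s} cᵢ) · (∫⋯∫⁻_s f ∂μ) x ≤ (∫⋯∫⁻_s f ∂ν) x` for measurable `f ≥ 0` and every `x`. -/
theorem prod_mul_lmarginal_le (h : ∀ i, c i • μ i ≤ ν i) {f : (∀ i, X i) → ℝ≥0∞}
    (hf : Measurable f) (s : Finset ι) (x : ∀ i, X i) :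
    (∏ i ∈ s, c i) * (∫⋯∫⁻_s, f ∂μ) x ≤ (∫⋯∫⁻_s, f ∂ν) x := by
  induction s using Finset.induction_on generalizing x with
  | empty => simp [lmarginal_empty]
  | @insert i s hi ih =>
    rw [Finset.prod_insert hi, lmarginal_insert _ hf hi, lmarginal_insert _ hf hi, mul_assoc]
    calc c i * ((∏ j ∈ s, c j) * ∫⁻ xᵢ, (∫⋯∫⁻_s, f ∂μ) (Function.update x i xᵢ) ∂μ i)
        ≤ c i * ∫⁻ xᵢ, (∫⋯∫⁻_s, f ∂ν) (Function.update x i xᵢ) ∂μ i := by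
          gcongr c i * ?_
          exact (lintegral_const_mul_le _ _).trans (lintegral_mono fun xᵢ => ih _)
      _ = ∫⁻ xᵢ, (∫⋯∫⁻_s, f ∂ν) (Function.update x i xᵢ) ∂(c i • μ i) := by
          rw [lintegral_smul_measure, smul_eq_mul]
      _ ≤ ∫⁻ xᵢ, (∫⋯∫⁻_s, f ∂ν) (Function.update x i xᵢ) ∂ν i := lintegral_mono' (h i) le_rfl

/-- **Coordinate-wise minorants multiply**: `cᵢ • μᵢ ≤ νᵢ` for every `i` (σ-finite families on a
finite index type) gives `(∏ᵢ cᵢ) • Measure.pi μ ≤ Measure.pi ν`. -/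
theorem smul_pi_le_pi [Fintype ι] (h : ∀ i, c i • μ i ≤ ν i) :
    (∏ i, c i) • Measure.pi μ ≤ Measure.pi ν := by
  refine Measure.le_iff.2 fun A hA => ?_
  rw [Measure.smul_apply, smul_eq_mul, ← lintegral_indicator_one hA, ← lintegral_indicator_one hA]
  rcases isEmpty_or_nonempty (∀ i, X i) with he | ⟨⟨x⟩⟩
  · simp [lintegral_of_isEmpty]
  · rw [lintegral_eq_lmarginal_univ (μ := μ) x, lintegral_eq_lmarginal_univ (μ := ν) x]
    exact prod_mul_lmarginal_le h ((show Measurable (1 : (∀ i, X i) → ℝ≥0∞) from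
      measurable_one).indicator hA) Finset.univ x

end Pi

/-! ## §3 The one-step P-first leapfrog: the proposed configuration is one drift of the kicked momentum -/

section KDK

variable {Q P : Type*} [AddCommGroup P]

/-- The one-step P-first leapfrog word: `palindromicWord [kick g] (drift d) = K(g) D(d) K(g)`. -/
theorem palindromicWord_kick_drift (g : Q → P) (d : P → Equiv.Perm Q) :
    palindromicWord [kick g] (drift d) = kick g * drift d * kick g := by
  simp [palindromicWord]

/-- **Pointwise formula for one P-first leapfrog step followed by the flip**: from `(u, π)`, with
the kicked momentum `π' = π + g u`, the proposal is `(d π' u, −(π' + g (d π' u)))`. -/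
theorem flip_kdk_apply (g : Q → P) (d : P → Equiv.Perm Q) (z : Q × P) :
    ((flip : Equiv.Perm (Q × P)) * palindromicWord [kick g] (drift d) ^ 1) z =
      (d (z.2 + g z.1) z.1, -(z.2 + g z.1 + g (d (z.2 + g z.1) z.1))) := by
  rw [pow_one, palindromicWord_kick_drift]
  rfl

/-- **The proposed CONFIGURATION of the one-step P-first leapfrog is `d (π + g u) u`**: one drift
driven by the kicked momentum (the closing kick and the flip only touch the momentum). -/
theorem fst_flip_kdk (g : Q → P) (d : P → Equiv.Perm Q) (z : Q × P) :
    (((flip : Equiv.Perm (Q × P)) * palindromicWord [kick g] (drift d) ^ 1) z).1 =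
      d (z.2 + g z.1) z.1 := by
  rw [flip_kdk_apply]

variable [MeasurableSpace Q] [MeasurableSpace P]

/-- **Doeblin minorant for one-step P-first leapfrog HMC.**  If a sub-law `ρ ≤ μP` of the
momentum refresh sees acceptance `≥ a` (`ρ`-a.e., from every configuration `u`) and the law of the
drifted configuration `d (π + g u) u`, `π ∼ ρ`, dominates `δ • π₀` from every `u`, then the HMC
configuration kernel (refresh, `K D K`, flip, Metropolis on `H`, forget) dominates `(a δ) • π₀`
from every `u`. -/
theorem kdkHMC_minorised {g : Q → P} {d : P → Equiv.Perm Q}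
    (hΨ : Measurable (⇑((flip : Equiv.Perm (Q × P)) * palindromicWord [kick g] (drift d) ^ 1)))
    {H : Q × P → ℝ} (hH : Measurable H) (μP : Measure P) [SFinite μP] {ρ : Measure P}
    (hρ : ρ ≤ μP) {a : ℝ≥0∞}
    (hacc : ∀ u, ∀ᵐ p ∂ρ, a ≤ involAcceptE H
      (⇑((flip : Equiv.Perm (Q × P)) * palindromicWord [kick g] (drift d) ^ 1)) (u, p))
    {π₀ : Measure Q} {δ : ℝ≥0∞} (hpush : ∀ u, δ • π₀ ≤ ρ.map (fun p => d (p + g u) u)) (u : Q) :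
    (a * δ) • π₀ ≤
      refreshUpdate (involMH (⇑((flip : Equiv.Perm (Q × P)) * palindromicWord [kick g] (drift d) ^ 1))
        hΨ H) μP u := by
  refine refreshUpdate_involMH_minorised hΨ hH μP hρ hacc (fun v => ?_) u
  have hfun : (fun p : P =>
      (((flip : Equiv.Perm (Q × P)) * palindromicWord [kick g] (drift d) ^ 1) (v, p)).1) =
      fun p => d (p + g v) v :=
    funext fun p => fst_flip_kdk g d (v, p)
  rw [hfun]
  exact hpush v

end KDK

end Summit.Ventures.LatticeQCDFlow.Exactness
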